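import Summits.HodgeConjecture.Ring2.LowDimensionHodgeOfMarkmanCaseGQuartic
import Literature.AlgebraicGeometry.HodgeTheory.QuarticCMTimesCMCurveProductSpan
import Literature.AlgebraicGeometry.HodgeTheory.EndFieldMultiplicitiesOfSubfield
import HarnessLib

/-!
# Ring 2 (cell topic `Summits/HodgeConjecture/Ring2/`; seat `lit`, gen 66, R40): Moonen–Zarhin 1999 Thm. 0.2 (3) case (g) with `End⁰(X₂)` a QUARTIC FIELD is CLOSED — the fivefold fact's residual is `[simple non-CM = Tankeev–Ribet] ∧ [(e) ∩ (a1)]`, and `HCUpToDim 5` modulo Markman and Tankeev–Ribet is `HC(row-four residual) ∧ HC((e) ∩ (a1))`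

HONEST FRAMING (cell `pub-hodge-ring2`, verbatim): research route conditional on HC_CM; not a corollary;
Q11.4-sentence-2 already refuted in dim ≥ 3. `HC_CM` does NOT occur in this file. Markman's theorem
(`Markman2025_weilClasses_algebraic_abelianFourfold`) and Tankeev–Ribet
(`TankeevRibet1983_hodgeClasses_divisorial_powers_simplePrimeDimension`) are HYPOTHESES of the axis theorems, never
asserted. Theorems only — no definition, no named fact, no `sorry`. The one NEW unconditional case of the Hodge
conjecture recorded here is a theorem of the Literature lane (`QuarticCMTimesCMCurveProductSpan` +
`EndFieldMultiplicitiesOfSubfield`, Moonen–Zarhin's printed case (g)); this file only threads it into the cell's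
residual statements.

THE PRINT. B. Moonen, Yu. Zarhin, Math. Ann. **315** (1999), Thm. 0.2 (3): «(g) The abelian variety `X` is isogenous to
a product `X₁ × X₂` where `X₁` is an elliptic curve with complex multiplication by an imaginary quadratic field `k`
and where `X₂` is a simple abelian fourfold such that there exists an embedding `k ↪ End⁰(X₂)` via which `k` acts on
`T_{X₂,0}` with multiplicities `(1,3)` … (3) Suppose we are in case (g). Then the Hodge ring `B•(X)` is generated by
divisor classes»; §5 (5.10) Case 2, (5.11).

THIS FILE.
* §1 **`hodgeConjectureFor_of_caseG_quarticField`** — for `X ∼ F × C` (or `C × F`), `C` an elliptic curve with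
  `χ ≫ χ = -d'`, `F` a SIMPLE fourfold whose `End⁰(F)` is a FIELD of degree `4`, `φ ∈ End(F)` with `φ ≫ φ = -n`
  (`n > 0`) of UNEQUAL multiplicities at `± i√n`: `B•(X) = D•(X)` and HC for `X`, UNCONDITIONALLY — the Literature
  lane's `exists_quarticCM_data_of_isField_of_eigenMultiplicity_ne` (the `F`-signature is `{(1,1),(2,0)}`) fed
  into `hodgeConjectureFor_of_isIsogenous_prod_cmCurve_of_quarticCM` (R40-G). Neither `¬ IsOfCMType F` nor the
  centrality of `φ` nor `ℚ(χ) ≅ ℚ(φ)` is needed.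
* §2 **`moonenZarhin1999_codimTwoHodgeClasses_abelianFivefold_iff_residual_caseE`** — the named fact
  `MoonenZarhin1999_codimTwoHodgeClasses_abelianFivefold` is EQUIVALENT to its instances at (α) the SIMPLE fivefolds
  NOT of CM type [Tankeev–Ribet] and (β) case (e) ∩ (a1) — `X ∼ E × (E × T)`, `E` a CM elliptic curve, `T` a simple
  threefold NOT of CM type with `dim_ℚ End⁰(T) = 2` and `End⁰(E) ↪ End⁰(T)` [Thm. 0.2 (1)]; the cell (γ') (case (g)
  with `End⁰(F)` a quartic field) of `NonCMFivefoldsCodimTwoResidualQuartic.…_iff_residual_quartic` is DISCHARGED by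
  §1; `…_iff_caseE_of_tankeevRibet`: granted Tankeev–Ribet, the fact ↔ (β) alone.
* §3 **`hcUpToDim_five_iff_rowFour_caseE_of_markman_of_tankeevRibet`** — granted Markman and Tankeev–Ribet:
  `HCUpToDim 5 ↔ HC(simple non-CM fourfolds, neither Ribet type (3,1) over `k = End⁰` nor minimal quaternion type)
  ∧ HC({`X ∼ E × (E × T)`: case (e) ∩ (a1)})`; on path `caseEResidualCell_of_hodgeConjecture`.

WHAT IS NOT CLAIMED: case (e) ∩ (a1) (two `E`-slots over a threefold of type IV(1,1)) is NOT closed; the row-four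
residual of the simple non-CM fourfolds (Moonen–Zarhin 1995) is NOT closed; Tankeev–Ribet and Markman are never
asserted; nothing on which quartic fields occur as `End⁰` of a simple fourfold.

## References
* [MoonenZarhin1999LowDim] B. Moonen, Yu. Zarhin, Math. Ann. 315 (1999) 711–733, Thm. 0.1, Thm. 0.2 (1), (3), cases
  (e), (g), §1 (1.1), §2 (2.3)–(2.4), Thm. (2.7), §5 (5.10)–(5.12).
* [Tankeev1983] S. G. Tankeev, *Cycles on simple abelian varieties of prime dimension*, Math. USSR-Izv. 20 (1983).
* [MumfordAV1970] D. Mumford, *Abelian Varieties* (1970), §19 Cor. 2, §21 (pp. 201–202).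
* [Deligne2000] P. Deligne, *The Hodge conjecture* (Clay problem description, 2000), §1.
* [vanGeemen1994HodgeAV] B. van Geemen, LNM 1594 (1994), §3.6 (p. 236), Lemma 3.7.
* [claim: Markman2025SurveySecant, status: under-review] E. Markman, arXiv:2509.23403, Thm. 1.2.
-/

noncomputable section

open CategoryTheory CategoryTheory.Limits

namespace Summit.HodgeConjecture.Ring2.CaseGQuarticField

open Literature.AlgebraicGeometry.Motives (AbelianVariety)
open Literature.AlgebraicGeometry.Motives.AbelianVariety
open Literature.AlgebraicGeometry.HodgeTheory
open Literature.AlgebraicGeometry.ComplexMultiplication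
open Literature.AlgebraicGeometry.Milne1999
open NumberField
open Literature.NumberTheory.Automorphic (IsQuaternionAlgebra)
open Summit.HodgeConjecture.HodgeConjecture.Ring2.ClassTargets
open Summit.HodgeConjecture.Ring2.NonCMFivefoldsCodimTwoResidualQuartic
open Summit.HodgeConjecture.Ring2.LowDimOfMarkman

/-! ### §1 Case (g) with `End⁰(F)` a quartic field: `B = D` and HC, unconditionally -/

/-- **Moonen–Zarhin 1999 Thm. 0.2 (3), case (g) with `End⁰(X₂) = F` a QUARTIC FIELD — `B•(X) = D•(X)` and the Hodge
conjecture for `X`, UNCONDITIONALLY.** `F` a simple fourfold whose endomorphism algebra is a field of degree `4`,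
`φ ∈ End(F)` with `φ ≫ φ = -n` (`n > 0`) acting on `H^{1,0}(F)` with unequal multiplicities at `± i√n` («`k ↪ End⁰(X₂)`
via which `k` acts on `T_{X₂,0}` with multiplicities `(1,3)`»), `C` an elliptic curve with `χ ≫ χ = -d'`, `X ∼ F × C`:
the Literature lane's bridge `exists_quarticCM_data_of_isField_of_eigenMultiplicity_ne` (the `F`-signature is
`{(1,1),(2,0)}`) and `hodgeConjectureFor_of_isIsogenous_prod_cmCurve_of_quarticCM` (R40-G).
[cite: MoonenZarhin1999LowDim, Thm. 0.2 (3) case (g) and §5 (5.10) Case 2, (5.11)] [cite: vanGeemen1994HodgeAV, §3.6 (p. 236) and Lemma 3.7] -/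
theorem hodgeConjectureFor_of_caseG_quarticField {X F C : AbelianVariety ℂ} (hFs : F.IsSimple) (hF4 : F.dim = 4)
    (hK : IsField F.endAlgebra) (hK4 : Module.finrank ℚ F.endAlgebra = 4) (φ : F ⟶ F) {n : ℕ} (hn : 0 < n)
    (hφ : φ ≫ φ = -(n • 𝟙 F))
    (hne : eigenMultiplicity F φ (Complex.I * (Real.sqrt n : ℂ)) ≠
      eigenMultiplicity F φ (-(Complex.I * (Real.sqrt n : ℂ))))
    (hC : C.dim = 1) (χ : C ⟶ C) {d' : ℕ} (hd' : 0 < d') (hχ : χ ≫ χ = -(d' • 𝟙 C))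
    (hX : AbelianVariety.IsIsogenous X (F.prod C)) :
    IsDivisorGenerated X ∧ HodgeConjectureFor X.dim X.X := by
  obtain ⟨β, μ₁, μ₂, h11, h22, h12, h12', hm1, hm1', hm2⟩ :=
    exists_quarticCM_data_of_isField_of_eigenMultiplicity_ne hFs hF4 hK hK4 φ hn hφ hne
  exact hodgeConjectureFor_of_isIsogenous_prod_cmCurve_of_quarticCM hFs β hK4 h11 h22 h12 h12' hm1 hm1' hm2 hF4 hC χ
    hd' hχ hX

/-- The order `X ∼ C × F`. [cite: MoonenZarhin1999LowDim, Thm. 0.2 (3) case (g)] [cite: vanGeemen1994HodgeAV, §3.6 (p. 236)] -/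
theorem hodgeConjectureFor_of_caseG_quarticField' {X F C : AbelianVariety ℂ} (hFs : F.IsSimple) (hF4 : F.dim = 4)
    (hK : IsField F.endAlgebra) (hK4 : Module.finrank ℚ F.endAlgebra = 4) (φ : F ⟶ F) {n : ℕ} (hn : 0 < n)
    (hφ : φ ≫ φ = -(n • 𝟙 F))
    (hne : eigenMultiplicity F φ (Complex.I * (Real.sqrt n : ℂ)) ≠
      eigenMultiplicity F φ (-(Complex.I * (Real.sqrt n : ℂ))))
    (hC : C.dim = 1) (χ : C ⟶ C) {d' : ℕ} (hd' : 0 < d') (hχ : χ ≫ χ = -(d' • 𝟙 C))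
    (hX : AbelianVariety.IsIsogenous X (C.prod F)) :
    IsDivisorGenerated X ∧ HodgeConjectureFor X.dim X.X :=
  hodgeConjectureFor_of_caseG_quarticField hFs hF4 hK hK4 φ hn hφ hne hC χ hd' hχ
    (hX.trans (isIsogenous_prod_comm C F))

/-! ### §2 The fivefold fact's residual: `[simple non-CM] ∧ [(e) ∩ (a1)]` -/

/-- **LOCALISATION OF THE NAMED FACT, FINAL FORM FOR CASE (g).** `MoonenZarhin1999_codimTwoHodgeClasses_abelianFivefold`
is EQUIVALENT to its instances at: (α) the SIMPLE fivefolds NOT of CM type [Tankeev–Ribet]; (β) case (e) ∩ (a1) —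
`X ∼ E × (E × T)`, `E` a CM elliptic curve, `T` a simple threefold NOT of CM type with `dim_ℚ End⁰(T) = 2` and
`End⁰(E) ↪ End⁰(T)` [Thm. 0.2 (1)]. Case (g) — both for `End⁰(X₂) = k` (R29) and for `End⁰(X₂)` a quartic field (§1) —
and the quaternion alternative (empty, `not_quaternionCell`) are theorems of the tree.
[cite: MoonenZarhin1999LowDim, Thm. 0.2 (1)–(4), §2 (2.4) and §5 (5.1), (5.10)–(5.12)] [cite: MumfordAV1970, §21 (pp. 201–202)] -/
theorem moonenZarhin1999_codimTwoHodgeClasses_abelianFivefold_iff_residual_caseE :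
    MoonenZarhin1999_codimTwoHodgeClasses_abelianFivefold ↔
      (∀ A : AbelianVariety ℂ, A.dim = 5 → A.IsSimple → ¬ IsOfCMType A → IsCodimTwoDivisorPullbackGenerated A) ∧
      (∀ A : AbelianVariety ℂ, A.dim = 5 →
        (∃ E T : AbelianVariety ℂ, E.dim = 1 ∧ IsOfCMType E ∧ T.IsSimple ∧ T.dim = 3 ∧
          Module.finrank ℚ T.endAlgebra = 2 ∧ ¬ IsOfCMType T ∧
          Nonempty (E.endAlgebra →+* T.endAlgebra) ∧ AbelianVariety.IsIsogenous A (E.prod (E.prod T))) →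
        IsCodimTwoDivisorPullbackGenerated A) := by
  rw [moonenZarhin1999_codimTwoHodgeClasses_abelianFivefold_iff_residual_quartic]
  refine ⟨fun ⟨hS, hE, _⟩ => ⟨hS, hE⟩, fun ⟨hS, hE⟩ => ⟨hS, hE, ?_⟩⟩
  rintro A - ⟨F, C, hFs, hF4, -, ⟨hK, hK4⟩, hC, hAFC, χ, d', hd', hχ, φ, M, hM, hφ, -, hneq, -⟩
  exact (hodgeConjectureFor_of_caseG_quarticField hFs hF4 hK hK4 φ (Nat.mul_pos (Nat.mul_pos hM hM) hd') hφ hneq hC χ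
    hd' hχ hAFC).1.isCodimTwoDivisorPullbackGenerated

/-- **GRANTED THE TANKEEV–RIBET FACT** (HYPOTHESIS `TankeevRibet1983_hodgeClasses_divisorial_powers_simplePrimeDimension`),
the fivefold fact is EQUIVALENT to its instances at case (e) ∩ (a1) alone.
[cite: MoonenZarhin1999LowDim, Thm. 0.2 (1) and §2 Thm. (2.7)] [cite: Tankeev1983, main theorem] -/
theorem moonenZarhin1999_codimTwoHodgeClasses_abelianFivefold_iff_caseE_of_tankeevRibet
    (hTR : TankeevRibet1983_hodgeClasses_divisorial_powers_simplePrimeDimension) :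
    MoonenZarhin1999_codimTwoHodgeClasses_abelianFivefold ↔
      (∀ A : AbelianVariety ℂ, A.dim = 5 →
        (∃ E T : AbelianVariety ℂ, E.dim = 1 ∧ IsOfCMType E ∧ T.IsSimple ∧ T.dim = 3 ∧
          Module.finrank ℚ T.endAlgebra = 2 ∧ ¬ IsOfCMType T ∧
          Nonempty (E.endAlgebra →+* T.endAlgebra) ∧ AbelianVariety.IsIsogenous A (E.prod (E.prod T))) →
        IsCodimTwoDivisorPullbackGenerated A) := by
  rw [moonenZarhin1999_codimTwoHodgeClasses_abelianFivefold_iff_residual_caseE]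
  refine ⟨fun h => h.2, fun h => ⟨fun A hA hs _ => ?_, h⟩⟩
  exact (isDivisorGenerated_powSucc_of_tankeevRibet hTR A (by norm_num : (5 : ℕ).Prime) hA hs 0)
    |>.isCodimTwoDivisorPullbackGenerated

/-! ### §3 The HC axis: `HCUpToDim 5` modulo Markman and Tankeev–Ribet is `HC(row four) ∧ HC((e) ∩ (a1))` -/

/-- **HC on the case-(g) quartic cell ∪ case (e) ∩ (a1) reduces to HC on case (e) ∩ (a1)** — the case-(g) quartic
members satisfy HC unconditionally (§1). [cite: MoonenZarhin1999LowDim, Thm. 0.2 (3) case (g) and §5 (5.10)–(5.11)] -/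
theorem hcOnClass_caseGQuartic_of_caseE
    (h : HCOnClass fun A => A.dim = 5 ∧
        (∃ E T : AbelianVariety ℂ, E.dim = 1 ∧ IsOfCMType E ∧ T.IsSimple ∧ T.dim = 3 ∧
          Module.finrank ℚ T.endAlgebra = 2 ∧ Nonempty (E.endAlgebra →+* T.endAlgebra) ∧
          AbelianVariety.IsIsogenous A (E.prod (E.prod T)))) :
    HCOnClass fun A => A.dim = 5 ∧
        ((∃ (C F : AbelianVariety ℂ) (χ : C ⟶ C) (d' : ℕ) (φ : F ⟶ F) (M : ℕ), C.dim = 1 ∧ 0 < d' ∧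
          χ ≫ χ = -(d' • 𝟙 C) ∧ F.IsSimple ∧ F.dim = 4 ∧ ¬ IsOfCMType F ∧
          IsField F.endAlgebra ∧ Module.finrank ℚ F.endAlgebra = 4 ∧ 0 < M ∧ φ ≫ φ = -((M * M * d') • 𝟙 F) ∧
          AbelianVariety.endAlgebra.of F φ ∈ Subalgebra.center ℚ F.endAlgebra ∧
          (eigenMultiplicity F φ (Complex.I * (Real.sqrt (M * M * d' : ℕ) : ℂ)) = 1 ∨
            eigenMultiplicity F φ (-(Complex.I * (Real.sqrt (M * M * d' : ℕ) : ℂ))) = 1) ∧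
          AbelianVariety.IsIsogenous A (C.prod F)) ∨
        (∃ E T : AbelianVariety ℂ, E.dim = 1 ∧ IsOfCMType E ∧ T.IsSimple ∧ T.dim = 3 ∧
          Module.finrank ℚ T.endAlgebra = 2 ∧ Nonempty (E.endAlgebra →+* T.endAlgebra) ∧
          AbelianVariety.IsIsogenous A (E.prod (E.prod T)))) := by
  rintro A ⟨hA5, ⟨C, F, χ, d', φ, M, hC, hd', hχ, hFs, hF4, -, hK, hK4, hM, hφ, -, hm1, hiso⟩ | hE⟩
  · have hpos : 0 < M * M * d' := Nat.mul_pos (Nat.mul_pos hM hM) hd'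
    exact (hodgeConjectureFor_of_caseG_quarticField' hFs hF4 hK hK4 φ hpos hφ
      (eigenMultiplicity_ne_of_eq_one_of_dim_eq_four hF4 φ hpos hφ hm1) hC χ hd' hχ hiso).2
  · exact h A ⟨hA5, hE⟩

/-- **`HCUpToDim 5` MODULO MARKMAN AND TANKEEV–RIBET: CASE (g) IS CLOSED.** Granted the tree's named facts
`Markman2025_weilClasses_algebraic_abelianFourfold` and `TankeevRibet1983_hodgeClasses_divisorial_powers_simplePrimeDimension`
(hypotheses), the Hodge conjecture for all complex abelian varieties of dimension `≤ 5` is EQUIVALENT to the Hodge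
conjecture on (α) the simple fourfolds not of CM type, neither of Ribet type `(3,1)` over `k = End⁰` nor of minimal
quaternion type [the rest of Moonen–Zarhin 1995], together with (β) the fivefolds `X ∼ X₁² × X₂`, `X₂` a simple
threefold with `dim_ℚ End⁰(X₂) = 2`, `X₁` a CM elliptic curve with `End⁰(X₁) ↪ End⁰(X₂)` [case (e) ∩ (a1), Thm. 0.2 (1)].
[cite: MoonenZarhin1999LowDim, Thm. 0.1, Thm. 0.2 (1), (3), §1 (1.1), §2 Thm. (2.7) and §5 (5.10)–(5.11)]
[cite: Tankeev1983, main theorem] [claim: Markman2025SurveySecant, status: under-review] -/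
theorem hcUpToDim_five_iff_rowFour_caseE_of_markman_of_tankeevRibet
    (hMark : Markman2025_weilClasses_algebraic_abelianFourfold)
    (hTR : TankeevRibet1983_hodgeClasses_divisorial_powers_simplePrimeDimension) :
    HCUpToDim 5 ↔ (HCOnClass fun A => A.dim = 4 ∧ A.IsSimple ∧ ¬ IsOfCMType A ∧
      (¬ ∃ (φ : A ⟶ A) (d : ℕ), 0 < d ∧ φ ≫ φ = -(d • 𝟙 A) ∧ Module.finrank ℚ A.endAlgebra = 2 ∧
        (eigenMultiplicity A φ (Complex.I * (Real.sqrt d : ℂ)) = 1 ∨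
          eigenMultiplicity A φ (-(Complex.I * (Real.sqrt d : ℂ))) = 1)) ∧
      (¬ ∃ (K : Type) (_ : Field K) (_ : NumberField K) (_ : IsTotallyReal K) (_ : Algebra K A.endAlgebra)
        (_ : IsScalarTower ℚ K A.endAlgebra) (_ : IsQuaternionAlgebra K A.endAlgebra), A.dim = 2 * Module.finrank ℚ K)) ∧
      HCOnClass fun A => A.dim = 5 ∧
        (∃ E T : AbelianVariety ℂ, E.dim = 1 ∧ IsOfCMType E ∧ T.IsSimple ∧ T.dim = 3 ∧
          Module.finrank ℚ T.endAlgebra = 2 ∧ Nonempty (E.endAlgebra →+* T.endAlgebra) ∧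
          AbelianVariety.IsIsogenous A (E.prod (E.prod T))) := by
  rw [hcUpToDim_five_iff_rowFour_caseGQuartic_of_markman_of_tankeevRibet hMark hTR]
  exact and_congr_right fun _ =>
    ⟨fun h => hcOnClass_mono (fun A hA => ⟨hA.1, Or.inr hA.2⟩) h, hcOnClass_caseGQuartic_of_caseE⟩

/-- **On path**: the residual cell of this file is a case of the summit. [cite: Deligne2000, §1] -/
theorem caseEResidualCell_of_hodgeConjecture (h : _root_.HodgeConjecture) :
    HCOnClass fun A => A.dim = 5 ∧
        (∃ E T : AbelianVariety ℂ, E.dim = 1 ∧ IsOfCMType E ∧ T.IsSimple ∧ T.dim = 3 ∧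
          Module.finrank ℚ T.endAlgebra = 2 ∧ Nonempty (E.endAlgebra →+* T.endAlgebra) ∧
          AbelianVariety.IsIsogenous A (E.prod (E.prod T))) :=
  hcOnClass_of_hodgeConjecture _ h

end Summit.HodgeConjecture.Ring2.CaseGQuarticField

end
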